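import Summits.CriticalPhenomena.SAWScalingLimit.Theses.SAWPtolemyBoundary

/-!
# Crux `PtolemyLoewnerRigidity` (stmt-CriticalPhenomena-15265) — birth skeleton `Lines/birth.lean`

Route `SAWPtolemyBoundary` (rank 4; sole owner), skeleton registrar planner-skel-stmt-CriticalPhenomena-15265-0
(2026-08-17); tree path `Summits/CriticalPhenomena/SAWScalingLimit/Cruxes/PtolemyLoewnerRigidity/Lines/birth.lean`.

Crux (FIXED, concluded BY NAME below):
`Summit.CriticalPhenomena.SAWScalingLimit.Theses.SAWPtolemyBoundary.PtolemyLoewnerRigidity` =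
`BoundaryPtolemy → RankOneBumps → ∀ P : ChordalFamily, P.IsChordal → (lim: P is the full scaling limit of the
critical δℤ² SAW laws, every Dobrushin domain, every endpoint approximation) → P.IsRestriction → (restriction-coupled
Markov extension) → (reversible) → (covariant under z ↦ r·i^k·z + w) → (conjugation covariant) → (simple,
boundary-avoiding) → P.IsConformallyCovariant` — the card's device "Ptolemy boundary + rank-one bumps force the Ptolemy
coordinate to flow by Loewner; LSW03 Prop. 5.3 backwards; D4 kills the residual real-linear map", at use level.

## The line: the card's own proof chain, cut at its two natural seams (3 registered stubs)

The card (ptolemy-boundary-loewner-rigidity, K2) proves the crux in three moves of very different status, and the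
skeleton registers exactly these:

* S1 `stub_bumpPassage` — `BumpPassage` (provable now, L): the lattice rank-one bump crux `RankOneBumps` (K3) PASSES
  TO THE LIMIT FAMILY: every chordal `P` that is the full SAW scaling limit, has restriction and simple
  boundary-avoiding curves has `ContinuumRankOneBumps P` — the same `√`-additivity inequality with the lattice laws
  replaced by `P (R.chord i j)`. The bump event `{range ⊆ closure Ω'}` is closed and its boundary (curves in
  `closure Ω'` touching `∂Ω' ∖ {marks}`) is `P`-null by restriction × boundary avoidance in `Ω'`, so portmanteau
  applies; lattice approximations of three marks exist as in `SAW.exists_isEndpointApprox`.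
* S2 `stub_shearedRigidity` — `ShearedRigidity` (OPEN, XL; the device, load-bearing): `BoundaryPtolemy` (K1) ⇒ every
  chordal `P` with (lim), restriction, restriction-coupled Markov, reversibility, covariance under DILATIONS AND
  TRANSLATIONS ONLY, conjugation, simplicity and `ContinuumRankOneBumps P` is a REAL-LINEAR IMAGE of chordal SLE(8/3):
  `IsShearedSLE P := ∃ L : ℂ ≃L[ℝ] ℂ, ∀ D, IsSLELaw (8/3) (D.map L) (L_* (P D))`. This is card K2 verbatim
  ("conclusion: law = f_* SLE_{8/3}, f real-linear, b = 5/8") with its honest hypotheses: NO ROTATION is available to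
  it, so it cannot be closed by the rival conjecture R* (`SAWRestrictionRigidity.Rigidity`, which consumes the
  quarter-turn) — the device must do the work; and on a sheared lattice the same statement is true with `L` the shear
  (barrier `EmbeddingModulusUniqueness` is embraced here, spent in S3).
* S3 `stub_quarterTurnUpgrade` — `QuarterTurnUpgrade` (provable from named facts, M/L): a chordal family covariant
  under `z ↦ r·i^k·z + w` that is a real-linear image of SLE(8/3) is conformally covariant ("D4 forces f = id"):
  quarter-turn covariance of `P = L⁻¹_* SLE(L·)` makes SLE(8/3) covariant under `L i L⁻¹ = c·φ_β`; for `β ≠ i`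
  Beffara's `BeffaraShearDistortsModulus` (Literature/Barriers) and the modulus-monotone SLE(8/3) restriction
  observable `P^{(ℍ;0,∞)}[γ ∩ A_{[c,d]} = ∅] = (4cd/(c+d)²)^{5/8}` contradict each other; so `L` is
  complex-(anti)linear and `P` is SLE(8/3) itself (`IsSLELaw.conformalCovariance`, similarity/reflection covariance).

Composition `PtolemyLoewnerRigidity_of` (kernel-checked, no `sorry` of its own): S1 fed with K3 gives
`ContinuumRankOneBumps P`; the crux's similarity clause restricted to `k = 0` is dilation/translation covariance; S2
fed with K1 gives `IsShearedSLE P`; S3 fed with the full similarity clause gives `P.IsConformallyCovariant` — the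
crux's conclusion. Every binder of the crux is consumed (K1 by S2, K3 by S1, rotations by S3).

What is deliberately NOT cut here: the passage of K1 (cross-ratios of partition functions — NOT law-visible data of
`P`) to Ptolemy coordinates of the limit stays inside S2 until the definition item `PtolemyBoundaryData` foreseen by
the route header (TWO-LAYER PLAN / DEFINITION REQUESTS; refuter note rreview-0816T14) exists; then S2 splits as
`BoundaryDataOfLimit → AbstractPtolemyRigidity` with no change to S1, S3 or the composition.

Disproof used: none (`ledger crux ls stmt-CriticalPhenomena-15265`: no `Disproof.lean`, no ideas, no dead lines on
2026-08-17). Negatives honoured (`ledger negatives --problem CriticalPhenomena`): the refuted all-`δ` tightness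
stmt-0772 is not used (everything is eventual in `δ` or a property of the limit family); no refuted statement concerns
bump additivity, boundary cross-ratios or linear images of SLE. Typing checklist 4c: no Bochner integral without
measurability (only measures of closed events and `toReal`), no hand-picked threshold (`∃ ε₀`, `∀ η > 0`).

Audit (farm `lean check --json`): rc 0, sorries = 3 = the three `stub_*` declarations, zero elsewhere;
`#h21_check_skeleton` ok, theorem `PtolemyLoewnerRigidity_of`, hypotheses = the three name-keyed stub statements.
BC3 probes (planner folder `bc/probe_S{1,2,3}_{crux,summit}.lean`): `Stub → PtolemyLoewnerRigidity` and
`Stub → SAWScalingLimit` by `first | exact? | simpa [Stub] | (unfold Stub; simpa) | aesop` all FAIL.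
-/

noncomputable section

namespace Summit.CriticalPhenomena.SAWScalingLimit.Cruxes.PtolemyLoewnerRigidity.Birth

open scoped NNReal ENNReal Topology
open MeasureTheory Filter Set
open Literature.Probability.RandomPlanarGeometry Literature.Probability.LatticeModels
open Summit.CriticalPhenomena.SAWScalingLimit.Theses.SAWPtolemyBoundary
  (BoundaryPtolemy RankOneBumps PtolemyLoewnerRigidity)

set_option linter.unusedVariables false

/-! ## The hypothesis clauses of the crux, as named predicates (each is the crux's binder VERBATIM) -/

/-- (lim) `P` is the FULL scaling limit of the critical `δℤ²` SAW laws: for every Dobrushin domain and every endpoint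
approximation, `TendstoLaw (curve) (SAW.law D δ a_δ b_δ) id (P D)` — the crux's third binder, verbatim. -/
def IsSAWLimit (P : ChordalFamily) : Prop :=
  ∀ (D : DobrushinDomain) (a b : ℝ → Site 2), SAW.IsEndpointApprox D a b →
    TendstoLaw (fun δ (γ : SAW.DomainSAW D.carrier δ (a δ) (b δ)) => γ.curve)
      (fun δ => SAW.law D.carrier δ (a δ) (b δ)) id (P D)

/-- Restriction-coupled domain Markov property (a Markov extension `Q` whose conditioning into every Jordan subdomain
`D'` of the remaining slit domain with `D'.pt 0 = tip` is `P D'`) — the crux's fifth binder, verbatim. -/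
def HasRestrictionMarkov (P : ChordalFamily) : Prop :=
  ∃ Q : DobrushinDomain → CurveClass ℂ → Measure (CurveClass ℂ), P.IsMarkovExtension Q ∧
    ∀ (D : DobrushinDomain) (p : CurveClass ℂ) (D' : DobrushinDomain), D'.carrier ⊆ remainingDomain D p →
      D'.pt 0 = p.target → D'.pt 1 = D.pt 1 → ∀ T : Set (CurveClass ℂ), MeasurableSet T →
        P D' T * Q D p (CurveClass.rangeSubset (closure D'.carrier)) =
          Q D p (T ∩ CurveClass.rangeSubset (closure D'.carrier))

/-- Reversibility `P (D; b, a) = reverse_* P (D; a, b)` — the crux's sixth binder, verbatim. -/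
def IsReversible (P : ChordalFamily) : Prop :=
  ∀ D D' : DobrushinDomain, D'.carrier = D.carrier → D'.pt 0 = D.pt 1 → D'.pt 1 = D.pt 0 →
    P D' = (P D).map CurveClass.reverse

/-- Covariance under the lattice similarities `z ↦ r·i^k·z + w` (`r > 0`, `k ∈ ℕ`, `w ∈ ℂ`: dilations, translations
and the QUARTER-TURNS of `ℤ²`) — the crux's seventh binder, verbatim. -/
def IsLatticeSimilarityCovariant (P : ChordalFamily) : Prop :=
  ∀ (D : DobrushinDomain) (c : ℂ) (hc : c ≠ 0) (w : ℂ), (∃ (r : ℝ) (k : ℕ), 0 < r ∧ c = (r : ℂ) * Complex.I ^ k) →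
    P (D.map (similarity c hc w)) = (P D).map (CurveClass.map (similarity c hc w : C(ℂ, ℂ)))

/-- Covariance under DILATIONS AND TRANSLATIONS ONLY, `z ↦ r·z + w` (`r > 0`): the rotation-free part of
`IsLatticeSimilarityCovariant` (its case `k = 0`). This is all the device (S2) may use; the quarter-turn is spent in S3. -/
def IsDilationTranslationCovariant (P : ChordalFamily) : Prop :=
  ∀ (D : DobrushinDomain) (c : ℂ) (hc : c ≠ 0) (w : ℂ), (∃ r : ℝ, 0 < r ∧ c = (r : ℂ)) →
    P (D.map (similarity c hc w)) = (P D).map (CurveClass.map (similarity c hc w : C(ℂ, ℂ)))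

/-- Covariance under complex conjugation — the crux's eighth binder, verbatim. -/
def IsConjCovariant (P : ChordalFamily) : Prop :=
  ∀ D : DobrushinDomain, P (D.map Complex.conjLIE.toHomeomorph) =
    (P D).map (CurveClass.map (Complex.conjLIE.toHomeomorph : C(ℂ, ℂ)))

/-- The curves are simple and meet `∂D` only at the two marked points — the crux's ninth binder, verbatim. -/
def IsSimpleBoundaryAvoiding (P : ChordalFamily) : Prop :=
  ∀ D : DobrushinDomain, ∀ᵐ γ ∂(P D), γ ∈ CurveClass.simple ∧ γ.range ∩ frontier D.carrier ⊆ {D.pt 0, D.pt 1}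

/-! ## The two new predicates of the line -/

/-- **Continuum rank-one bump response of the family `P` itself** (the law-visible continuum form of the lattice crux
`RankOneBumps`, K3 of the card): for every conformal rectangle `R = (Ω; u, v, w, ξ)`, every non-degeneracy `θ ∈ (0, 1]`
and `η > 0` there is `ε₀ > 0` such that for every conformal rectangle `R' ⊆ R` with the same `u, v, w`, obtained by
removing from `Ω` a bump inside `B(ξ, ε)` containing `Ω ∩ B(ξ, θε)`, `ε < ε₀`:
`|√h(u,w) − √h(u,v) − √h(v,w)| ≤ η √h(u,w)`, where `h(x,y) := 1 − P^{(Ω; x, y)}(range ⊆ closure Ω')` is the probability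
that the `(x,y)`-chord OF THE FAMILY `P` in the big domain leaves the bumped one (`R.chord i j`: the Dobrushin domain
`(Ω; pt i, pt j)`). For chordal SLE(8/3): `h ≈ (5/8)·a_ε·(F(u) − F(w))²`, `F = 1/(φ(·) − φ(ξ))`, exactly additive. -/
def ContinuumRankOneBumps (P : ChordalFamily) : Prop :=
  ∀ (R : ConformalRectangle) (θ : ℝ), 0 < θ → ∀ η : ℝ, 0 < η → ∃ ε₀ : ℝ, 0 < ε₀ ∧
    ∀ (R' : ConformalRectangle) (ε : ℝ), 0 < ε → ε < ε₀ → R'.carrier ⊆ R.carrier →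
      (∀ i : Fin 3, R'.pt i.castSucc = R.pt i.castSucc) →
      R.carrier \ R'.carrier ⊆ Metric.ball (R.pt 3) ε →
      R.carrier ∩ Metric.ball (R.pt 3) (θ * ε) ⊆ R.carrier \ R'.carrier →
      |Real.sqrt (1 - (P (R.chord 0 2 (by decide)) (CurveClass.rangeSubset (closure R'.carrier))).toReal) -
          Real.sqrt (1 - (P (R.chord 0 1 (by decide)) (CurveClass.rangeSubset (closure R'.carrier))).toReal) -
          Real.sqrt (1 - (P (R.chord 1 2 (by decide)) (CurveClass.rangeSubset (closure R'.carrier))).toReal)| ≤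
        η * Real.sqrt (1 - (P (R.chord 0 2 (by decide)) (CurveClass.rangeSubset (closure R'.carrier))).toReal)

/-- **`P` is a real-linear image of chordal SLE(8/3)** ("law `= f_* SLE_{8/3}`, `f` real-linear" — the conclusion of
the card's continuum theorem K2 BEFORE the quarter-turn is spent): there is an invertible `ℝ`-linear map `L` of the
plane such that, in every Dobrushin domain `D`, the `L`-image of `P D` is the chordal SLE(8/3) law of the image domain
`L(D)` (`IsSLELaw`, `MarkedDomain.map`). With `L = 1` this says `P D` is SLE(8/3) in every `D`; with `L` a genuine shear
it is the Beffara picture of a sheared lattice. -/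
def IsShearedSLE (P : ChordalFamily) : Prop :=
  ∃ L : ℂ ≃L[ℝ] ℂ, ∀ D : DobrushinDomain,
    IsSLELaw ((8 : ℝ≥0) / 3) (D.map L.toHomeomorph) ((P D).map (CurveClass.map (L.toHomeomorph : C(ℂ, ℂ))))

/-! ## Statements of the line (the three stub statements) -/

/-- **(S1) Lattice rank-one bumps pass to the limit family.** `RankOneBumps` (K3, lattice, eventual in `δ`) ⇒ every
chordal family that is the full scaling limit of the critical SAW, has two-sided restriction and is carried by simple
boundary-avoiding curves has the continuum rank-one bump response `ContinuumRankOneBumps`. Content: lattice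
approximations of three marks of a conformal rectangle exist; for each bumped rectangle the closed event
`{range ⊆ closure Ω'}` is a continuity set of the limit law (its boundary consists of curves in `closure Ω'` touching
`∂Ω' ∖ {marks}`, null by restriction × boundary avoidance in `Ω'`), so portmanteau turns the eventual lattice
inequality into the continuum one. -/
def BumpPassage : Prop :=
  RankOneBumps → ∀ P : ChordalFamily, P.IsChordal → IsSAWLimit P → P.IsRestriction →
    IsSimpleBoundaryAvoiding P → ContinuumRankOneBumps P

/-- **(S2) Sheared rigidity — the device** (card K2 with the `D4` input withheld; OPEN, XL, load-bearing).
`BoundaryPtolemy` (K1, lattice Ptolemy of the germ-free cross-ratios of critical SAW partition functions) ⇒ every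
chordal family `P` that is the full SAW scaling limit, has restriction, the restriction-coupled Markov property,
reversibility, covariance under DILATIONS AND TRANSLATIONS ONLY and under conjugation, simple boundary-avoiding curves,
AND the continuum rank-one bump response, is a real-linear image of chordal SLE(8/3) (`IsShearedSLE`). Content:
(a) K1 + (lim) + restriction give the limit's boundary two-point data Ptolemy coordinates `θ_D` (one modulus per cyclic
quadruple); (b) Ptolemy + rank one + restriction + Markov + dilations/translations force `θ_t` of the slit domains to
flow by Loewner (the V-lemma: `R[V] = −(G(U)−G(W))²` has only the pole solution mod `psl₂`); (c) LSW03 Prop. 5.3 read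
BACKWARDS: `ψ_t'(W_t)^b` a martingale for every hull with `W` unknown ⇒ drift `0`, `⟨W⟩_t = (8/3)t`, `b = 5/8`;
(d) hull identification ⇒ the law is `f_* SLE_{8/3}` with `f` real-linear. No rotation is used — on a sheared lattice
the same statement holds with `L` the shear (barrier EmbeddingModulusUniqueness embraced, not evaded). -/
def ShearedRigidity : Prop :=
  BoundaryPtolemy → ∀ P : ChordalFamily, P.IsChordal → IsSAWLimit P → P.IsRestriction →
    HasRestrictionMarkov P → IsReversible P → IsDilationTranslationCovariant P → IsConjCovariant P →
    IsSimpleBoundaryAvoiding P → ContinuumRankOneBumps P → IsShearedSLE P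

/-- **(S3) The quarter-turn kills the shear** ("`D4` forces `f = id`"): a chordal family covariant under the lattice
similarities `z ↦ r·i^k·z + w` which is a real-linear image of chordal SLE(8/3) is conformally covariant. Content:
`P = L⁻¹_* SLE(L ·)` and quarter-turn covariance make the SLE(8/3) family covariant under `M = L i L⁻¹ = c·φ_β`
(`φ_β` a Beffara shear, `β ∈ ℍ`); if `β ≠ i`, Beffara's lemma (`BeffaraShearDistortsModulus`) gives two conformal
rectangles of equal modulus with `φ_β`-images of different moduli, contradicting the `φ_β`-invariance of an SLE(8/3)
restriction observable strictly monotone in the modulus (`P^{(ℍ;0,∞)}[γ ∩ A_{[c,d]} = ∅] = (4cd/(c+d)²)^{5/8}`); so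
`L` is complex-(anti)linear, `P = SLE_{8/3}` by similarity/reflection covariance of SLE, hence conformally covariant
(`IsSLELaw.conformalCovariance`). -/
def QuarterTurnUpgrade : Prop :=
  ∀ P : ChordalFamily, P.IsChordal → IsLatticeSimilarityCovariant P → IsShearedSLE P → P.IsConformallyCovariant

/-! ## Registered stubs (`sorry` only here) -/

/-- **S1 `stub_bumpPassage`** — `BumpPassage` (provable now, L). Route for the prover: pick lattice approximations
`q : Fin 3 → ℝ → Site 2` of `R.pt 0, 1, 2` pairwise joined in `Ω_δ` eventually (as in `SAW.exists_isEndpointApprox`);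
take `ε₀` = min of K3's `ε₀(R, q, θ, η)` and the distances from `R.pt 3` to the other marks; for an admissible `(R', ε)`
and each pair `(i, j)`, `(R.chord i j) ⊇ (R'.chord i j)` have the same marked points, so restriction and boundary
avoidance in `R'.chord i j` make `{range ⊆ closure R', range ∩ closure (R ∖ R') ≠ ∅}` null for `P (R.chord i j)`; the
open event `{range ∩ closure (R ∖ R') = ∅}` and the closed event `{range ⊆ closure R'}` then squeeze
`P_δ(range ⊆ closure R') → P (R.chord i j) (range ⊆ closure R')` (portmanteau along `𝓝[>] 0`, laws are probability
measures eventually); pass to the limit in K3's non-strict inequality. -/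
theorem stub_bumpPassage : BumpPassage := by
  sorry

/-- **S2 `stub_shearedRigidity`** — `ShearedRigidity` (OPEN, XL; the device; card K2 without `D4`). Why it might fail
(card + route): (i) extracting the driving process `W_t = Θ_t(γ(t))` needs a semimartingale / conditional fourth-moment
a-priori without harmonic measure; (ii) hull map ⇒ point map for thin hulls; (iii) `C³` regularity and non-degenerate
3-jets of the limit's Ptolemy coordinates must come from lattice data (K1 is a statement about partition functions, not
about `P`). Foreseen split once `PtolemyBoundaryData` is defined: `BoundaryDataOfLimit` (K1 + (lim) + restriction ⇒
Ptolemy coordinates of `P`) → `AbstractPtolemyRigidity` (pure continuum theorem). Cheapest falsifier: a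
restriction–Markov, dilation-covariant simple-chord family with Ptolemaic boundary data and rank-one bumps that is not a
real-linear image of SLE(8/3) (the V-lemma's solution space was checked 6-dimensional by the card's author). -/
theorem stub_shearedRigidity : ShearedRigidity := by
  sorry

/-- **S3 `stub_quarterTurnUpgrade`** — `QuarterTurnUpgrade` (provable from named facts, M/L). Inputs by name:
`IsSLELaw.conformalCovariance`, `IsSLELaw.hullRestriction_eightThirds` (the `Φ_A'(0)^{5/8}` formula),
`exists_isSLECurve` / `IsSLECurve.map_eq` (SLE(8/3) is a well-defined law), and
`Literature.Barriers.CriticalPhenomena.BeffaraShearDistortsModulus`; every real-linear orientation-preserving map is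
`c·moduliShear β` with `β ∈ ℍ`. Degenerate cases: `L` complex-antilinear is absorbed by reflection symmetry of SLE. -/
theorem stub_quarterTurnUpgrade : QuarterTurnUpgrade := by
  sorry

/-! ### Name-keyed aliases of the three statements — the hypotheses of `PtolemyLoewnerRigidity_of`

The native skeleton audit (`#h21_check_skeleton`) admits a hypothesis of the skeleton theorem only if its head constant
is a registered obligation or is NAMED like a declared stub; `__Registered.stub_X` is the statement of `stub_X` under
that name (device of `Cruxes/AxiomsOfLimit/Lines/birth.lean`, `Cruxes/HarmonicPassage/Lines/birth.lean`). Each alias is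
`rfl`-equal to its statement. -/
namespace __Registered

/-- Alias of `BumpPassage` keyed by the registered stub name. -/
abbrev stub_bumpPassage : Prop := BumpPassage
/-- Alias of `ShearedRigidity` keyed by the registered stub name. -/
abbrev stub_shearedRigidity : Prop := ShearedRigidity
/-- Alias of `QuarterTurnUpgrade` keyed by the registered stub name. -/
abbrev stub_quarterTurnUpgrade : Prop := QuarterTurnUpgrade

end __Registered

/-! ## The skeleton theorem: the three stubs imply the crux, BY NAME (kernel-checked, no `sorry` of its own) -/

/-- **`PtolemyLoewnerRigidity` from the line `birth`.** S1 (fed with K3) gives the continuum rank-one bump response of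
`P`; the crux's lattice-similarity clause at `k = 0` is dilation/translation covariance; S2 (fed with K1) gives a
real-linear `L` with `L_* P = SLE_{8/3}(L ·)`; S3 (fed with the full clause, i.e. the quarter-turn) upgrades to
conformal covariance. Hypotheses = the three stubs under their registered names; conclusion = the route decl, by name. -/
theorem PtolemyLoewnerRigidity_of (hPass : __Registered.stub_bumpPassage)
    (hRig : __Registered.stub_shearedRigidity) (hD4 : __Registered.stub_quarterTurnUpgrade) :
    Summit.CriticalPhenomena.SAWScalingLimit.Theses.SAWPtolemyBoundary.PtolemyLoewnerRigidity := by
  intro hK1 hK3 P hch hlim hres hmk hrev hsim hconj hsimple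
  -- S1: the lattice rank-one bump response passes to the limit family
  have hL : ContinuumRankOneBumps P := hPass hK3 P hch hlim hres hsimple
  -- the rotation-free part of the similarity clause
  have hdil : IsDilationTranslationCovariant P := by
    intro D c hc w hr
    obtain ⟨r, hr0, hcr⟩ := hr
    exact hsim D c hc w ⟨r, 0, hr0, by rw [hcr, pow_zero, mul_one]⟩
  -- S2: the device — a real-linear image of SLE(8/3)
  have hS : IsShearedSLE P := hRig hK1 P hch hlim hres hmk hrev hdil hconj hsimple hL
  -- S3: the quarter-turn kills the shear
  exact hD4 P hch hsim hS

/-- Wiring check (an `example`, so that `PtolemyLoewnerRigidity_of` stays the only theorem concluding the crux): the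
registered stubs feed the skeleton theorem as stated — this term becomes the crux proof when the three `sorry`s are
discharged. -/
example : Summit.CriticalPhenomena.SAWScalingLimit.Theses.SAWPtolemyBoundary.PtolemyLoewnerRigidity :=
  PtolemyLoewnerRigidity_of stub_bumpPassage stub_shearedRigidity stub_quarterTurnUpgrade

/-! ## Pins (documentation, sorry-free): the clause predicates ARE the crux's binders; the new predicates are inhabited
in kind -/

/-- Dilation/translation covariance is the `k = 0` case of the crux's lattice-similarity clause. [folklore] -/
theorem isDilationTranslationCovariant_of_lattice {P : ChordalFamily} (h : IsLatticeSimilarityCovariant P) :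
    IsDilationTranslationCovariant P := by
  intro D c hc w hr
  obtain ⟨r, hr0, hcr⟩ := hr
  exact h D c hc w ⟨r, 0, hr0, by rw [hcr, pow_zero, mul_one]⟩

/-- The quarter-turn `z ↦ i z` is a lattice similarity (`r = 1`, `k = 1`): the input S3 spends. [folklore] -/
theorem quarterTurn_of_lattice {P : ChordalFamily} (h : IsLatticeSimilarityCovariant P) (D : DobrushinDomain) :
    P (D.map (similarity Complex.I Complex.I_ne_zero 0)) =
      (P D).map (CurveClass.map (similarity Complex.I Complex.I_ne_zero 0 : C(ℂ, ℂ))) :=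
  h D Complex.I Complex.I_ne_zero 0 ⟨1, 1, one_pos, by simp⟩

/-- Shape check: the crux is literally "K1 → K3 → ∀ P, chordal → (lim) → restriction → Markov → reversible →
lattice similarities → conjugation → simple ⇒ conformally covariant" over the clause predicates of this file
(definitional unfolding only). -/
example :
    Summit.CriticalPhenomena.SAWScalingLimit.Theses.SAWPtolemyBoundary.PtolemyLoewnerRigidity ↔
      (BoundaryPtolemy → RankOneBumps → ∀ P : ChordalFamily, P.IsChordal → IsSAWLimit P → P.IsRestriction →
        HasRestrictionMarkov P → IsReversible P → IsLatticeSimilarityCovariant P → IsConjCovariant P →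
        IsSimpleBoundaryAvoiding P → P.IsConformallyCovariant) :=
  Iff.rfl

end Summit.CriticalPhenomena.SAWScalingLimit.Cruxes.PtolemyLoewnerRigidity.Birth

end
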